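import Mathlib
import Summits.AtomisticToContinuum.FouriersLaw.Theorems.EmbeddedDrudeMourreDrudeDissolutionResonanceStructure
import Summits.AtomisticToContinuum.FouriersLaw.Theorems.EmbeddedDrudeMourreDrudeDissolutionFloorLocal
import Summits.AtomisticToContinuum.FouriersLaw.Theorems.EmbeddedDrudeMourreDrudeDissolutionSheetTransversality
import Summits.AtomisticToContinuum.FouriersLaw.Theorems.EmbeddedDrudeMourreDrudeDissolutionStubExcursionSecondDifferenceCriticalSet
import Summits.AtomisticToContinuum.FouriersLaw.Theorems.EmbeddedDrudeMourreMourreDissolutionPlaneTransversal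
import Summits.AtomisticToContinuum.FouriersLaw.Theorems.EmbeddedDrudeMourreDrudeDissolutionStubExcursionSecondDifferenceGradientFloorCornerAux
import HarnessLib

/-!
# The local gradient floor of the pair resonance at every non-corner point
(crux `EmbeddedDrudeMourre.DrudeDissolution`, item stmt-AtomisticToContinuum-12593; `--supports` file for the
registered sub-goal `resonance_floor_local` of stub B1b″ `stub_excursionSecondDifference` of line
`kinetic-polymer-gas-on-the-time-axis`; closes nothing; lead c13 (process B), 2026-08-17)

WHAT. `resonance_floor_local`: for `ω₂ > 0`, `Ω(p) = resonanceFn ω₂ p.1 p.2.2 p.2.1 = −A·S₁·S₂`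
(`resonance_product_structure`), `D = (∂₁Ω)² + (∂₂Ω)² + (∂₃Ω)²` in the frame `(1,0,0),(0,1,0),(0,0,1)` and
`μ = A²S₁² + A²S₂² + S₁²S₂²`: at every point `p₀` which is not a translate of one of the two corners
(`(1−cos k₁)+(1−cos k₂)+(1+cos k₃) ≠ 0` and `(1+cos k₁)+(1+cos k₂)+(1−cos k₃) ≠ 0`) there is `c > 0` with
`c·μ ≤ D` on a neighbourhood of `p₀`.

HOW. If `D(p₀) > 0`: `floorLocal_regular`. If `D(p₀) = 0`, the three partials `v₁−v₄, v₄−v₃, v₂−v₄` vanish,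
so by `resonanceFn_criticalSet` (corners excluded) `S₁(p₀) = 0` or `S₂(p₀) = 0`; then
`S₁ = 0, S₂ ≠ 0 ⇒ A = 0` (from `∂₁Ω = S₂(A c₁ − a₁S₁) = 0`, `c₁ ≠ 0`) and `floorLocal_curve` with
`sheet_transversal₁`; symmetrically `floorLocal_curve` (indices swapped) with `sheet_transversal₂`;
`S₁ = S₂ = 0, A ≠ 0`: `floorLocal_diag`; `S₁ = S₂ = A = 0`: `floorLocal_triple` with `sheet_transversal_diag`.

WHY (role). Item (C4) of the remaining concrete work for B1b″: compactness then gives the gradient floor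
`D ≥ c·μ` off the corner balls (next file).
-/

noncomputable section

open scoped Topology
open Filter

namespace Summit.AtomisticToContinuum.FouriersLaw.Theorems.DrudeDissolution.KineticPolymerGasOnTheTimeAxis

open Literature.MathematicalPhysics.KineticTheory
open Literature.MathematicalPhysics.KineticTheory.PhononBoltzmann

/-- **Registered sub-goal `resonance_floor_local` of stub B1b″: the local gradient floor at every non-corner
point.** See the module docstring. [folklore] -/
theorem resonance_floor_local :
    ∀ ω₂ : ℝ, 0 < ω₂ → ∀ (A S₁ S₂ : ℝ × ℝ × ℝ → ℝ),
      (∀ p : ℝ × ℝ × ℝ, S₁ p = Real.sin ((p.2.1 - p.1) / 2)) →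
      (∀ p : ℝ × ℝ × ℝ, S₂ p = Real.sin ((p.2.1 - p.2.2) / 2)) →
      (∀ p : ℝ × ℝ × ℝ, A p =
        8 * ((dispersion ω₂ p.1 * dispersion ω₂ p.2.2 +
                dispersion ω₂ p.2.1 * dispersion ω₂ (p.1 + p.2.2 - p.2.1) + 2 * (ω₂ + 2)) *
              Real.cos ((p.1 + p.2.2) / 2) -
            4 * Real.cos ((p.2.1 - p.1) / 2) * Real.cos ((p.2.2 - p.2.1) / 2)) /
          ((dispersion ω₂ p.1 + dispersion ω₂ p.2.2 + dispersion ω₂ p.2.1 + dispersion ω₂ (p.1 + p.2.2 - p.2.1)) *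
            (dispersion ω₂ p.1 * dispersion ω₂ p.2.2 +
              dispersion ω₂ p.2.1 * dispersion ω₂ (p.1 + p.2.2 - p.2.1)))) →
      ∀ p₀ : ℝ × ℝ × ℝ,
        (1 - Real.cos p₀.1) + (1 - Real.cos p₀.2.2) + (1 + Real.cos p₀.2.1) ≠ 0 →
        (1 + Real.cos p₀.1) + (1 + Real.cos p₀.2.2) + (1 - Real.cos p₀.2.1) ≠ 0 →
        ∃ c : ℝ, 0 < c ∧ ∀ᶠ p in 𝓝 p₀,
          c * (A p ^ 2 * S₁ p ^ 2 + A p ^ 2 * S₂ p ^ 2 + S₁ p ^ 2 * S₂ p ^ 2) ≤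
            (fderiv ℝ (fun q : ℝ × ℝ × ℝ => resonanceFn ω₂ q.1 q.2.2 q.2.1) p (1, 0, 0)) ^ 2 +
              (fderiv ℝ (fun q : ℝ × ℝ × ℝ => resonanceFn ω₂ q.1 q.2.2 q.2.1) p (0, 1, 0)) ^ 2 +
              (fderiv ℝ (fun q : ℝ × ℝ × ℝ => resonanceFn ω₂ q.1 q.2.2 q.2.1) p (0, 0, 1)) ^ 2 := by
  intro ω₂ hω A S₁ S₂ hS₁ hS₂ hA p₀ hE₁ hE₂
  obtain ⟨k₁, k₃, k₂⟩ := p₀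
  simp only at hE₁ hE₂
  -- the cast
  set Ω : ℝ × ℝ × ℝ → ℝ := fun q => resonanceFn ω₂ q.1 q.2.2 q.2.1 with hΩ
  set P₁ : ℝ × ℝ × ℝ → ℝ := fun p => fderiv ℝ Ω p (1, 0, 0) with hP₁def
  set P₃ : ℝ × ℝ × ℝ → ℝ := fun p => fderiv ℝ Ω p (0, 1, 0) with hP₃def
  set P₂ : ℝ × ℝ × ℝ → ℝ := fun p => fderiv ℝ Ω p (0, 0, 1) with hP₂def
  set a₁ : ℝ × ℝ × ℝ → ℝ := fun p => fderiv ℝ A p (1, 0, 0) with ha₁def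
  set a₃ : ℝ × ℝ × ℝ → ℝ := fun p => fderiv ℝ A p (0, 1, 0) with ha₃def
  set a₂ : ℝ × ℝ × ℝ → ℝ := fun p => fderiv ℝ A p (0, 0, 1) with ha₂def
  set c₁ : ℝ × ℝ × ℝ → ℝ := fun p => Real.cos ((p.2.1 - p.1) / 2) / 2 with hc₁def
  set c₂ : ℝ × ℝ × ℝ → ℝ := fun p => Real.cos ((p.2.1 - p.2.2) / 2) / 2 with hc₂def
  show ∃ c : ℝ, 0 < c ∧ ∀ᶠ p in 𝓝 (k₁, k₃, k₂),
    c * (A p ^ 2 * S₁ p ^ 2 + A p ^ 2 * S₂ p ^ 2 + S₁ p ^ 2 * S₂ p ^ 2) ≤ P₁ p ^ 2 + P₃ p ^ 2 + P₂ p ^ 2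
  -- the product-rule shapes of the three partials
  have hprod := resonance_fderiv_Omega hω hS₁ hS₂ hA
  have hP₁ : ∀ p, P₁ p = -(a₁ p * S₁ p * S₂ p) + A p * c₁ p * S₂ p := fun p => by
    rw [hP₁def, ha₁def, hc₁def]; simp only; rw [hprod p (1, 0, 0)]; ring
  have hP₂ : ∀ p, P₂ p = -(a₂ p * S₁ p * S₂ p) + A p * S₁ p * c₂ p := fun p => by
    rw [hP₂def, ha₂def, hc₂def]; simp only; rw [hprod p (0, 0, 1)]; ring
  have hP₃ : ∀ p, P₃ p = -(a₃ p * S₁ p * S₂ p) - A p * c₁ p * S₂ p - A p * S₁ p * c₂ p := fun p => by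
    rw [hP₃def, ha₃def, hc₁def, hc₂def]; simp only; rw [hprod p (0, 1, 0)]; ring
  -- continuity everywhere
  have hA2 : ContDiff ℝ 2 A := resonance_contDiff_A hω hA 2
  have hAc : Continuous A := hA2.continuous
  have hS₁c : Continuous S₁ := (resonance_contDiff_S₁ hS₁ 0).continuous
  have hS₂c : Continuous S₂ := (resonance_contDiff_S₂ hS₂ 0).continuous
  have hDAc : Continuous fun p => fderiv ℝ A p := hA2.continuous_fderiv (by norm_num)
  have ha₁c : Continuous a₁ := hDAc.clm_apply continuous_const
  have ha₂c : Continuous a₂ := hDAc.clm_apply continuous_const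
  have ha₃c : Continuous a₃ := hDAc.clm_apply continuous_const
  have hc₁c : Continuous c₁ := by
    rw [hc₁def]
    exact (Real.continuous_cos.comp (((continuous_fst.comp continuous_snd).sub continuous_fst).div_const 2)).div_const 2
  have hc₂c : Continuous c₂ := by
    rw [hc₂def]
    exact (Real.continuous_cos.comp
      (((continuous_fst.comp continuous_snd).sub (continuous_snd.comp continuous_snd)).div_const 2)).div_const 2
  have hΩ1 : ContDiff ℝ 1 Ω := resonance_contDiff_Omega hω 1
  have hDΩc : Continuous fun p => fderiv ℝ Ω p := hΩ1.continuous_fderiv one_ne_zero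
  have hP₁c : Continuous P₁ := hDΩc.clm_apply continuous_const
  have hP₂c : Continuous P₂ := hDΩc.clm_apply continuous_const
  have hP₃c : Continuous P₃ := hDΩc.clm_apply continuous_const
  have hb₁ : ∀ p, |S₁ p| ≤ 1 := fun p => by rw [hS₁]; exact Real.abs_sin_le_one _
  have hb₂ : ∀ p, |S₂ p| ≤ 1 := fun p => by rw [hS₂]; exact Real.abs_sin_le_one _
  -- a global bound on `μ`
  obtain ⟨CA, hCA0, hCA⟩ := resonance_A_bounds hω hA (fun _ : Fin 3 => (1, 0, 0))
  have hμM : ∀ p, A p ^ 2 * S₁ p ^ 2 + A p ^ 2 * S₂ p ^ 2 + S₁ p ^ 2 * S₂ p ^ 2 ≤ 2 * CA ^ 2 + 1 := by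
    intro p
    have hA' : A p ^ 2 ≤ CA ^ 2 := by
      have := pow_le_pow_left₀ (abs_nonneg _) (hCA p).1 2; rwa [sq_abs] at this
    have s1 : S₁ p ^ 2 ≤ 1 := by
      have := pow_le_pow_left₀ (abs_nonneg _) (hb₁ p) 2; rwa [sq_abs, one_pow] at this
    have s2 : S₂ p ^ 2 ≤ 1 := by
      have := pow_le_pow_left₀ (abs_nonneg _) (hb₂ p) 2; rwa [sq_abs, one_pow] at this
    have h1 := mul_le_mul hA' s1 (sq_nonneg _) (sq_nonneg _)
    have h2 := mul_le_mul hA' s2 (sq_nonneg _) (sq_nonneg _)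
    have h3 := mul_le_mul_of_nonneg_left s2 (sq_nonneg (S₁ p))
    linarith
  -- transversality
  have hT := sheet_transversality ω₂ hω A S₁ S₂ hS₁ hS₂ hA
  -- case split on `D(p₀)`
  rcases (show 0 ≤ P₁ (k₁, k₃, k₂) ^ 2 + P₃ (k₁, k₃, k₂) ^ 2 + P₂ (k₁, k₃, k₂) ^ 2 by positivity).eq_or_lt
    with hD0 | hDpos
  swap
  · -- regular point
    exact floorLocal_regular (D := fun p => P₁ p ^ 2 + P₃ p ^ 2 + P₂ p ^ 2)
      (((hP₁c.pow 2).add (hP₃c.pow 2)).add (hP₂c.pow 2)).continuousAt hDpos (by positivity) hμM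
  -- critical point: the three partials vanish
  have q1 := sq_nonneg (P₁ (k₁, k₃, k₂))
  have q3 := sq_nonneg (P₃ (k₁, k₃, k₂))
  have q2 := sq_nonneg (P₂ (k₁, k₃, k₂))
  have h1 : P₁ (k₁, k₃, k₂) = 0 := pow_eq_zero_iff (n := 2) two_ne_zero |>.1 (by linarith)
  have h3 : P₃ (k₁, k₃, k₂) = 0 := pow_eq_zero_iff (n := 2) two_ne_zero |>.1 (by linarith)
  have h2 : P₂ (k₁, k₃, k₂) = 0 := pow_eq_zero_iff (n := 2) two_ne_zero |>.1 (by linarith)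
  -- hence `S₁(p₀) = 0` or `S₂(p₀) = 0`
  have hcrit : S₁ (k₁, k₃, k₂) = 0 ∨ S₂ (k₁, k₃, k₂) = 0 := by
    obtain ⟨f1, f3, f2⟩ := fderiv_resonanceFn₃_apply_basis hω (k₁, k₃, k₂)
    have e1 : fderiv ℝ Ω (k₁, k₃, k₂) (1, 0, 0) = 0 := h1
    have e3 : fderiv ℝ Ω (k₁, k₃, k₂) (0, 1, 0) = 0 := h3
    have e2 : fderiv ℝ Ω (k₁, k₃, k₂) (0, 0, 1) = 0 := h2
    rw [hΩ] at e1 e2 e3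
    rw [e1] at f1
    rw [e3] at f3
    rw [e2] at f2
    simp only at f1 f2 f3
    have v12 : groupVelocity ω₂ k₁ = groupVelocity ω₂ k₂ := by linarith
    have v23 : groupVelocity ω₂ k₂ = groupVelocity ω₂ k₃ := by linarith
    have v34 : groupVelocity ω₂ k₃ = groupVelocity ω₂ (k₁ + k₂ - k₃) := by linarith
    rcases resonanceFn_criticalSet ω₂ hω k₁ k₂ k₃ v12 v23 v34 with ⟨n, hn⟩ | ⟨n, hn⟩ | hc | hc
    · left
      rw [hS₁]; simp only
      rw [hn, show (k₁ + 2 * Real.pi * n - k₁) / 2 = n * Real.pi by ring]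
      exact Real.sin_int_mul_pi n
    · right
      rw [hS₂]; simp only
      rw [hn, show (k₂ + 2 * Real.pi * n - k₂) / 2 = n * Real.pi by ring]
      exact Real.sin_int_mul_pi n
    · exfalso; apply hE₁; rw [hc.1, hc.2.1, hc.2.2]; ring
    · exfalso; apply hE₂; rw [hc.1, hc.2.1, hc.2.2]; ring
  -- `cᵢ(p₀) ≠ 0` on the respective planes
  have hc₁0 : S₁ (k₁, k₃, k₂) = 0 → c₁ (k₁, k₃, k₂) ≠ 0 := fun h => by
    rw [hS₁] at h
    rw [hc₁def]
    exact div_ne_zero (MourreDissolution.planeTransversal_cos_ne_zero h) two_ne_zero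
  have hc₂0 : S₂ (k₁, k₃, k₂) = 0 → c₂ (k₁, k₃, k₂) ≠ 0 := fun h => by
    rw [hS₂] at h
    rw [hc₂def]
    exact div_ne_zero (MourreDissolution.planeTransversal_cos_ne_zero h) two_ne_zero
  have hP₃0 : ∀ p, 0 ≤ P₃ p ^ 2 := fun p => sq_nonneg _
  by_cases hs1 : S₁ (k₁, k₃, k₂) = 0
  · by_cases hs2 : S₂ (k₁, k₃, k₂) = 0
    · by_cases hA0 : A (k₁, k₃, k₂) = 0
      · -- triple point
        have hβ : a₁ (k₁, k₃, k₂) + a₂ (k₁, k₃, k₂) + a₃ (k₁, k₃, k₂) ≠ 0 := by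
          have := (hT k₁ k₃ k₂).2.2 hs1 hs2 hA0
          rw [ha₁def, ha₂def, ha₃def]; simp only
          rwa [add_right_comm]
        exact floorLocal_triple A S₁ S₂ a₁ a₂ a₃ c₁ c₂ P₁ P₂ P₃ (k₁, k₃, k₂) ha₁c.continuousAt ha₂c.continuousAt
          ha₃c.continuousAt hc₁c.continuousAt hc₂c.continuousAt hP₁ hP₂ hP₃ hβ (hc₁0 hs1) (hc₂0 hs2)
      · -- diagonal, off the triple points
        obtain ⟨c, hc, hev⟩ := floorLocal_diag hAc.continuousAt hS₁c.continuousAt hS₂c.continuousAt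
          ha₁c.continuousAt ha₂c.continuousAt hc₁c.continuousAt hc₂c.continuousAt hP₁ hP₂ hb₂ hs1 hs2 hA0
          (hc₁0 hs1) (hc₂0 hs2)
        exact ⟨c, hc, hev.mono fun p hp => by linarith [hP₃0 p]⟩
    · -- first co-moving curve: `S₁ = 0`, `S₂ ≠ 0`, hence `A = 0`
      have hA0 : A (k₁, k₃, k₂) = 0 := by
        have e := hP₁ (k₁, k₃, k₂)
        rw [h1, hs1] at e
        have : A (k₁, k₃, k₂) * c₁ (k₁, k₃, k₂) * S₂ (k₁, k₃, k₂) = 0 := by linarith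
        rcases mul_eq_zero.1 this with h | h
        · rcases mul_eq_zero.1 h with h' | h'
          · exact h'
          · exact absurd h' (hc₁0 hs1)
        · exact absurd h hs2
      have hα : a₂ (k₁, k₃, k₂) ≠ 0 := (hT k₁ k₃ k₂).1 hs1 hA0
      obtain ⟨c, hc, hev⟩ := floorLocal_curve hAc.continuousAt hS₂c.continuousAt ha₁c.continuousAt
        ha₂c.continuousAt hc₁c.continuousAt hc₂c.continuousAt hP₁ hP₂ hb₁ hb₂ hA0 hs2 hα (hc₁0 hs1)
      exact ⟨c, hc, hev.mono fun p hp => by linarith [hP₃0 p]⟩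
  · -- second co-moving curve: `S₂ = 0`, `S₁ ≠ 0`, hence `A = 0`; the curve lemma with indices swapped
    have hs2 : S₂ (k₁, k₃, k₂) = 0 := hcrit.resolve_left hs1
    have hA0 : A (k₁, k₃, k₂) = 0 := by
      have e := hP₂ (k₁, k₃, k₂)
      rw [h2, hs2] at e
      have : A (k₁, k₃, k₂) * S₁ (k₁, k₃, k₂) * c₂ (k₁, k₃, k₂) = 0 := by linarith
      rcases mul_eq_zero.1 this with h | h
      · rcases mul_eq_zero.1 h with h' | h'
        · exact h'
        · exact absurd h' hs1
      · exact absurd h (hc₂0 hs2)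
    have hα : a₁ (k₁, k₃, k₂) ≠ 0 := (hT k₁ k₃ k₂).2.1 hs2 hA0
    have hP₁' : ∀ p, P₂ p = -(a₂ p * S₂ p * S₁ p) + A p * c₂ p * S₁ p := fun p => by rw [hP₂ p]; ring
    have hP₂' : ∀ p, P₁ p = -(a₁ p * S₂ p * S₁ p) + A p * S₂ p * c₁ p := fun p => by rw [hP₁ p]; ring
    obtain ⟨c, hc, hev⟩ := floorLocal_curve hAc.continuousAt hS₁c.continuousAt ha₂c.continuousAt
      ha₁c.continuousAt hc₂c.continuousAt hc₁c.continuousAt hP₁' hP₂' hb₂ hb₁ hA0 hs1 hα (hc₂0 hs2)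
    exact ⟨c, hc, hev.mono fun p hp => by nlinarith [hP₃0 p]⟩

end Summit.AtomisticToContinuum.FouriersLaw.Theorems.DrudeDissolution.KineticPolymerGasOnTheTimeAxis

end
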